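import Summits.AnomalousDissipation.AnomalousDissipation.Theorems.SolenoidalFractalHomogenisationLagrangianStepZ7GlueEulerianW
import Summits.AnomalousDissipation.AnomalousDissipation.Theorems.SolenoidalFractalHomogenisationLagrangianStepZ7GlueR
import Summits.AnomalousDissipation.AnomalousDissipation.Theorems.SolenoidalFractalHomogenisationLagrangianStepZ7GlueBookkeeping
import Summits.AnomalousDissipation.AnomalousDissipation.Theorems.SolenoidalFractalHomogenisationLagrangianStepZ7GlueTemplate
import Summits.AnomalousDissipation.AnomalousDissipation.Theorems.SolenoidalFractalHomogenisationLagrangianStepZ7GlueEulerThetaDefs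
import HarnessLib

/-!
# K1L_D (stmt-AnomalousDissipation-27980), §9z GLUE SIBLING WITH AN EXTRA CLAUSE BINDER THREADED (generic `X`, and the (V_θ) instance):
# `cellInputs_BIL_ofEulerX X hX e he : Vmod_E_textHTX X e → cellInputs_alphaBeta_textP → §9zX` (helper; `--supports … --as helper`; prover lead-k1l-onelevel-p1 g6;
# tenure RULINGS D27-16, D28-1 (3)/(4); sibling of `…Z7GlueEuler` (`cellInputs_BIL_ofEuler`, p710224) — untouched)

RULING D28-1: the (V_θ) input is threaded as a separate binder after the (V) line in every consumer text; generic form = a clause-shaped predicate `X`.  This file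
proves the glue for ANY `X` that is antitone in the threshold `ν₀` (`hX` — the glue feeds the clause at `min ν₀ 1`): `cellInputs_BIL_ofEuler`'s proof VERBATIM with
`hX'` passed to the first hypothesis; §9zX = the §9z text with the line `X W M hM c Φ lo hi Λ β σ C ν₀ K →` after its (V) line.  The `X := Xθ` instances are PARKED (RULING D28-2, v28 HOLD pending certifier F-p5g15-1 on the (V_θ) text).
NOT a proof of `Vmod_E_textHTθ`, of the αβ text, of `stub_cellInputs`, of the crux, or of AD; rung F-D1.A0.
-/

set_option linter.dupNamespace false  -- the summit-side namespace `Summit.AnomalousDissipation.AnomalousDissipation.…` repeats a component by design (D-0017)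

noncomputable section

namespace Summit.AnomalousDissipation.AnomalousDissipation.Theorems.SolenoidalFractalHomogenisation.LagrangianStep.Z7Glue

open Literature.Analysis Literature.Analysis.FluidPDE Literature.Analysis.FunctionSpaces
open MeasureTheory Set Filter UnitAddTorus
open scoped ENNReal NNReal InnerProductSpace
open Literature.Analysis.FluidPDE.LatticeShear (LagrangianLatticeCarrier LatticeWord)
open Summit.AnomalousDissipation.AnomalousDissipation.Theorems.SolenoidalFractalHomogenisation.LagrangianStep.CellClauseMod
open Summit.AnomalousDissipation.AnomalousDissipation.Theorems.SolenoidalFractalHomogenisation.LagrangianRenormalisationStep (cellVisc_pos')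

set_option maxHeartbeats 1600000 in
/-- **THE GLUE SIBLING, extra binder `X` threaded** (generic; `hX` = antitone in `ν₀`). -/
theorem cellInputs_BIL_ofEulerX (X : ∀ {k : ℕ}, LatticeWord k → (M : ℝ) → 0 < M → ℝ → (ℝ → Torus.Visc4 (Fin 3) → Torus.Visc4 (Fin 3)) → ℝ → ℝ → ℝ → ℝ → ℝ → ℝ → ℝ → ℝ → Prop)
    (hX : ∀ {k : ℕ} (W : LatticeWord k) (M : ℝ) (hM : 0 < M) (c : ℝ) (Φ : ℝ → Torus.Visc4 (Fin 3) → Torus.Visc4 (Fin 3))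
      (lo hi Λ β σ C ν₀ ν₀' K : ℝ), ν₀' ≤ ν₀ → X W M hM c Φ lo hi Λ β σ C ν₀ K → X W M hM c Φ lo hi Λ β σ C ν₀' K)
    (e : ℝ → ℝ) (he : ∀ σ : ℝ, 0 < σ → 0 < e σ) :
    Vmod_E_textHTX X e →
    cellInputs_alphaBeta_textP →
 ∀ k (W : Literature.Analysis.FluidPDE.LatticeShear.LatticeWord k) (M : ℝ) (hM : 0 < M) (c : ℝ), 0 < c →
    ∀ (Φ : ℝ → Torus.Visc4 (Fin 3) → Torus.Visc4 (Fin 3)) (lo hi Λ β σ C ν₀ K Cf νf Kf : ℝ),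
      0 < lo → lo ≤ 1 → 1 ≤ hi → 1 < Λ → 0 ≤ β →
      0 < σ → 0 ≤ C → 0 < ν₀ → 0 < K → SlowVectorClauseF W M hM c Φ lo hi Λ β σ C ν₀ K →
      X W M hM c Φ lo hi Λ β σ C ν₀ K →
      0 ≤ Cf → 0 < νf → 0 < Kf → CellEnergyClausesW W M hM c lo hi Λ β Cf νf Kf →
      (∀ Kb : ℝ, 1 ≤ Kb → ∃ CK : ℝ, 1 ≤ CK ∧ ∃ cK > (0:ℝ), ∃ νh > (0:ℝ), HighLabelDecayW W M hM lo hi Λ β νh Kb CK cK) →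
      ∃ ν₁ > (0:ℝ), ∃ K₁ > (0:ℝ), ∃ Λ₀ : ℕ, ∃ θ₀ > (0:ℝ), ∃ Cz > (0:ℝ), ∃ σz > (0:ℝ),
        ∀ E : Literature.Analysis.FluidPDE.LatticeShear.LagrangianLatticeCarrier k, E.design = W.stretch M hM → E.gain = c → E.nu0 ≤ ν₁ → K₁ ≤ E.K →
          E.LPermissible → E.Regular → (∀ m, Λ₀ * E.N m ≤ E.N (m + 1)) → (∀ m, E.N m ^ 2 ≤ E.N (m + 1)) →
          (∀ m, E.cellVisc (m + 1) * ((E.N (m + 1) : ℝ) / E.N m) ^ (1 / 4 : ℝ) ≤ 1) →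
          (∀ m, E.K * ((E.N (m + 1) : ℝ) / E.N m) ^ (1 / 4 : ℝ) ≤ ((E.N (m + 1) : ℝ) / E.N m) * E.cellVisc (m + 1)) →
          (∀ m, E.θ (m + 1) * ((E.N (m + 1) : ℝ) / E.N m) ^ (1 / 16 : ℝ) ≤ θ₀) →
          (∀ m, ((E.N (m + 1) : ℝ) / E.N m) ^ (1 / 16 : ℝ) * E.physPeriod (m + 1) ≤ E.refresh (m + 1)) →
        ∃ mstar : ℕ, ∀ m, mstar ≤ m →
          ∀ Lc : ℕ, Lc = ⌊((E.N m : ℝ) / E.N (m + 1)) ^ (1 / 64 : ℝ) * (E.N (m + 1) * E.cellVisc (m + 1)) / Real.sqrt c⌋₊ →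
          ∀ S : Torus.Visc4 (Fin 3), Torus.OddSmall S β → Torus.NearIso S lo hi →
            Torus.OddSmall (Φ (E.cellVisc (m + 1)) S) β → Torus.NearIso (Φ (E.cellVisc (m + 1)) S) lo hi →
          ∀ Um Um1 : ℝ → ℝ → (V2 →L[ℝ] V2),
            Torus.IsPropagator 1 (E.partialSum m) (E.kbar m • renormStep (Φ (E.cellVisc (m + 1))) (E.gain / E.cellVisc (m + 1) ^ 2) S) Um →
            Torus.IsPropagator 1 (E.partialSum (m + 1)) (E.kbar (m + 1) • S) Um1 →
          ∀ ηz ε : ℝ, ηz = Cz * ((E.N m : ℝ) / E.N (m + 1)) ^ σz →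
            ε = ((E.N m : ℝ) / E.N (m + 1)) ^ σz * (1 - Real.exp (-(4 * Real.pi ^ 2 * (E.kbar m * lo)))) * E.refresh (m + 1) →
          ∀ S : Finset (Fin 3 → ℤ), S = (Torus.freqBall (Lc / 2)).erase 0 →
          ∀ (j : ℕ) (s' : ℝ), (j : ℝ) * E.refresh (m + 1) + E.refresh (m + 1) ≤ s' →
            s' ≤ (j : ℝ) * E.refresh (m + 1) + 2 * E.refresh (m + 1) → s' ≤ 1 →
            ∀ x y : V2,
              |⟪Um1 ((j : ℝ) * E.refresh (m + 1)) s' x - Um ((j : ℝ) * E.refresh (m + 1)) s' x, y⟫_ℝ| ≤ ηz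
                * Real.sqrt (∑ k' ∈ S, min 1 ((E.a (m + 1) * (8 * Real.pi ^ 2 * ‖Torus.latticeVec k'‖ ^ 2 * lo * (E.cellVisc (m + 1) + c / E.cellVisc (m + 1)) / (E.N (m + 1) : ℝ) ^ 2)) * (s' - (j : ℝ) * E.refresh (m + 1))) * ‖UnitAddTorus.mFourierCoeff (EuclideanSpace.complexify ∘ ⇑(x)) k'‖ ^ 2
                      + (‖x‖ ^ 2 - ∑ k' ∈ S, ‖UnitAddTorus.mFourierCoeff (EuclideanSpace.complexify ∘ ⇑(x)) k'‖ ^ 2))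
                * Real.sqrt (∑ k' ∈ S, min 1 ((E.a (m + 1) * (8 * Real.pi ^ 2 * ‖Torus.latticeVec k'‖ ^ 2 * lo * (E.cellVisc (m + 1) + c / E.cellVisc (m + 1)) / (E.N (m + 1) : ℝ) ^ 2)) * (s' - (j : ℝ) * E.refresh (m + 1))) * ‖UnitAddTorus.mFourierCoeff (EuclideanSpace.complexify ∘ ⇑(y)) k'‖ ^ 2
                      + (‖y‖ ^ 2 - ∑ k' ∈ S, ‖UnitAddTorus.mFourierCoeff (EuclideanSpace.complexify ∘ ⇑(y)) k'‖ ^ 2)) := by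
  intro H1 H2 k W M hM c hc Φ lo hi Λ β σ C ν₀ K Cf νf Kf hlo hlo1 hhi hΛ hβ hσ hC hν₀ hK hV hXv hCf hνf hKf hF hH
  -- the re-cut (V_mod) input: exponent `σ' = min σ ½`, threshold `min ν₀ 1`
  set σ' : ℝ := e σ with hσ'_def
  have hσ' : 0 < σ' := he σ hσ
  have hν₀1 : 0 < min ν₀ 1 := lt_min hν₀ one_pos
  obtain ⟨θ₁, hθ₁, ϱ₁, hϱ₁, Cm, hCCm, hMod⟩ := H1 k W M hM c hc Φ lo hi Λ β σ C (min ν₀ 1) K hlo hlo1 hhi hΛ hβ hσ hC hν₀1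
    (min_le_right _ _) hK (slowVectorClauseF_mono_ν₀ (min_le_left _ _) hV) (hX W M hM c Φ lo hi Λ β σ C ν₀ (min ν₀ 1) K (min_le_left _ _) hXv) hH
  obtain ⟨ν₁', hν₁', K₁', hK₁', Λ₀', θ₀', hθ₀', Cα₀, _hCα₀, ϱ₀, _hϱ₀, CN, hCN, Cmono, hCmono, hE⟩ :=
    H2 k W M hM c hc Φ lo hi Λ β σ C ν₀ K Cf νf Kf hlo hlo1 hhi hΛ hβ hσ hC hν₀ hK hV hCf hνf hKf hF hH
  -- the EulerPiece error functional carries `θ(m+1)` and `N m/N(m+1)` bare: run the bookkeeping with `Cα = ϱ = 1`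
  obtain ⟨Cα, hCα, hCα1⟩ : ∃ Cα : ℝ, 0 < Cα ∧ Cα = 1 := ⟨1, one_pos, rfl⟩
  obtain ⟨ϱ, hϱ, hϱ1⟩ : ∃ ϱ : ℝ, 0 < ϱ ∧ ϱ = 1 := ⟨1, one_pos, rfl⟩
  -- constants
  have hCm : 0 ≤ Cm := hC.trans hCCm
  set θ₀ : ℝ := min θ₀' (θ₁ / Cα) with hθ₀_def
  have hθ₀ : 0 < θ₀ := lt_min hθ₀' (div_pos hθ₁ hCα)
  set cA : ℝ := 1 + (2:ℝ) ^ σ' + (Cα * θ₀) ^ σ' + ϱ ^ σ' with hcA_def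
  have hcA : 0 ≤ cA := by
    have h1 : 0 ≤ (2:ℝ) ^ σ' := Real.rpow_nonneg (by norm_num) σ'
    have h2 : 0 ≤ (Cα * θ₀) ^ σ' := Real.rpow_nonneg (by positivity) σ'
    have h3 : 0 ≤ ϱ ^ σ' := Real.rpow_nonneg hϱ.le σ'
    rw [hcA_def]; linarith only [h1, h2, h3]
  set Cη : ℝ := Cm * (Cm * cA + 1) with hCη_def
  have hCη : 0 ≤ Cη := by rw [hCη_def]; positivity
  set Cz : ℝ := CN * Cη * (Real.sqrt (2 * Cmono) + Real.sqrt 2 * Cη + 1) + 1 with hCz_def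
  have hCz : 0 < Cz := by rw [hCz_def]; positivity
  set σz : ℝ := min σ' (1 / 2) / 16 with hσz_def
  have hσz : 0 < σz := (sigmaz_facts hσ').1
  set Λ₀ : ℕ := max Λ₀' (max 16 (⌈ϱ / ϱ₁⌉₊ + 1)) with hΛ₀_def
  refine ⟨min ν₁' (min ν₀ 1), lt_min hν₁' hν₀1, max K₁' K, lt_max_of_lt_left hK₁', Λ₀, θ₀, hθ₀, Cz, hCz, σz, hσz, ?_⟩
  intro E hdes hgain hnu0 hKE hLP hReg hT1 hN2 hT2 hT3 hT4 hT5
  have hT1' : ∀ m, Λ₀' * E.N m ≤ E.N (m + 1) := fun m =>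
    le_trans (Nat.mul_le_mul_right _ (le_max_left _ _)) (hT1 m)
  have hT4' : ∀ m, E.θ (m + 1) * ((E.N (m + 1) : ℝ) / E.N m) ^ (1 / 16 : ℝ) ≤ θ₀' := fun m => (hT4 m).trans (min_le_left _ _)
  obtain ⟨mstar, hm⟩ := hE E hdes hgain (hnu0.trans (min_le_left _ _)) ((le_max_left _ _).trans hKE) hLP hReg hT1' hN2 hT2 hT3 hT4' hT5
  refine ⟨mstar, fun m hmm => ?_⟩
  intro Lc hLc S hSo hSn hΦSo hΦSn Um Um1 hUm hUm1 ηz ε hηz hε Sf hSf j s' h1 h2 h3 x y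
  obtain ⟨-, -, hN1, hN1s, hN2'⟩ := hm m hmm Lc hLc S hSo hSn hΦSo hΦSn Um Um1 hUm hUm1 Sf hSf j s' h1 h2 h3
  -- the level's numbers
  set ν : ℝ := E.cellVisc (m + 1) with hν_def
  set R : ℝ := E.refresh (m + 1) with hR_def
  set ρ : ℝ := (E.N m : ℝ) / E.N (m + 1) with hρ_def
  set r₁ : ℝ := ((j : ℝ) + 1) * E.refresh (m + 1) with hr₁_def
  set sj : ℝ := (j : ℝ) * E.refresh (m + 1) with hsj_def
  have hν : 0 < ν := cellVisc_pos' E.toFractalCarrierData (m + 1)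
  have ha : 0 < E.a (m + 1) := E.a_pos (m + 1)
  have hN : (0:ℝ) < E.N (m + 1) := by exact_mod_cast E.N_pos (m + 1)
  have hNm : (0:ℝ) < E.N m := by exact_mod_cast E.N_pos m
  obtain ⟨hρ0, hρ1, hρΛ⟩ := rho_facts E m (hT1 m) (hN2 m)
  have hR : 0 < R := E.refresh_pos (m + 1)
  have hr₁ : r₁ = sj + R := by rw [hr₁_def, hsj_def, hR_def]; ring
  have hsj0 : 0 ≤ sj := by rw [hsj_def]; positivity
  have hsjr₁ : sj < r₁ := by rw [hr₁]; linarith only [hR]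
  have hr₁s' : r₁ ≤ s' := by rw [hr₁]; exact h1
  have hs'R : s' - r₁ ≤ R := by rw [hr₁]; linarith only [h2]
  -- the separation constant: `ρ ≤ 1/16`, `ϱ ρ ≤ ϱ₁`-type facts
  have hΛ₀16 : (16:ℝ) ≤ (Λ₀ : ℝ) := by
    have : (16:ℕ) ≤ Λ₀ := (le_max_left _ _).trans (le_max_right _ _)
    exact_mod_cast this
  have hΛ₀ϱ : ϱ / ϱ₁ ≤ (Λ₀ : ℝ) := by
    have h1 : ϱ / ϱ₁ ≤ (⌈ϱ / ϱ₁⌉₊ : ℝ) := Nat.le_ceil _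
    have h2 : ((⌈ϱ / ϱ₁⌉₊ + 1 : ℕ) : ℝ) ≤ (Λ₀ : ℝ) := by
      have : ⌈ϱ / ϱ₁⌉₊ + 1 ≤ Λ₀ := (le_max_right _ _).trans (le_max_right _ _)
      exact_mod_cast this
    push_cast at h2; linarith only [h1, h2]
  have hΛ₀pos : (0:ℝ) < Λ₀ := by linarith only [hΛ₀16]
  have hρ16 : ρ ≤ 1 / 16 := by
    rw [le_div_iff₀ (by norm_num : (0:ℝ) < 16)]
    calc ρ * 16 ≤ ρ * Λ₀ := mul_le_mul_of_nonneg_left hΛ₀16 hρ0.le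
      _ ≤ 1 := hρΛ
  -- side conditions of the clause
  have hνν₀ : ν < min ν₀ 1 := lt_of_lt_of_le (hLP.permissible.2.2.2.2.1 (m + 1) (by omega)) (hnu0.trans (min_le_right _ _))
  have hKE' : K ≤ E.K := (le_max_right _ _).trans hKE
  obtain ⟨hKn, hqρ⟩ := ceil_facts E m hK.le hKE' hρ16 (hT3 m)
  obtain ⟨hθρ, hθθ₀⟩ := theta_facts E m (hN2 m) (hT4 m)
  have hθθ₁ : Cα * E.θ (m + 1) ≤ θ₁ := by
    have h1 : E.θ (m + 1) ≤ θ₁ / Cα := hθθ₀.trans (min_le_right _ _)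
    calc Cα * E.θ (m + 1) ≤ Cα * (θ₁ / Cα) := mul_le_mul_of_nonneg_left h1 hCα.le
      _ = θ₁ := by field_simp
  have hϱϱ₁ : ϱ * E.N m ≤ ϱ₁ * E.N (m + 1) := by
    -- `ϱ ≤ ϱ₁ Λ₀` and `Λ₀ N m ≤ N (m+1)`
    have h1 : ϱ ≤ ϱ₁ * Λ₀ := by rw [div_le_iff₀ hϱ₁] at hΛ₀ϱ; linarith only [hΛ₀ϱ]
    have h2 : ((Λ₀ : ℕ) : ℝ) * (E.N m : ℝ) ≤ (E.N (m + 1) : ℝ) := by exact_mod_cast hT1 m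
    calc ϱ * E.N m ≤ (ϱ₁ * Λ₀) * E.N m := mul_le_mul_of_nonneg_right h1 hNm.le
      _ = ϱ₁ * ((Λ₀ : ℝ) * E.N m) := by ring
      _ ≤ ϱ₁ * E.N (m + 1) := mul_le_mul_of_nonneg_left h2 hϱ₁.le
  -- bookkeeping inputs
  have hνρ : ν ≤ ρ ^ (1 / 4 : ℝ) := nu_le_rpow E m (hT2 m)
  have hθρ' : Cα * E.θ (m + 1) ≤ Cα * θ₀ * ρ ^ (1 / 16 : ℝ) := by
    have h1 : E.θ (m + 1) ≤ θ₀ * ρ ^ (1 / 16 : ℝ) := by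
      have := (theta_facts E m (hN2 m) (hT4 m)).1; exact this
    calc Cα * E.θ (m + 1) ≤ Cα * (θ₀ * ρ ^ (1 / 16 : ℝ)) := mul_le_mul_of_nonneg_left h1 hCα.le
      _ = Cα * θ₀ * ρ ^ (1 / 16 : ℝ) := by ring
  have hrρ : ϱ * E.N m / E.N (m + 1) ≤ ϱ * ρ := by rw [hρ_def, mul_div_assoc]
  have hA : ν ^ σ' + ((⌈K / ν⌉₊ : ℝ) / E.N (m + 1)) ^ σ' + (Cα * E.θ (m + 1)) ^ σ' + (ϱ * E.N m / E.N (m + 1)) ^ σ' ≤ cA * ρ ^ σz :=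
    smallTerms_le hσ' hρ0 hρ1 hν.le (by positivity) (by have := E.θ_pos (m + 1); positivity) (by positivity) hCα.le hθ₀.le hϱ.le
      hνρ hqρ hθρ' hrρ
  obtain ⟨hP1eq, hPR, hP0⟩ := period_facts E m hdes (hT5 m) (r₁ - sj)
  have hρz0 : 0 ≤ ρ ^ σz := Real.rpow_nonneg hρ0.le σz
  have hρz1 : ρ ^ σz ≤ 1 := Real.rpow_le_one hρ0.le hρ1 hσz.le
  -- piece 1: `[sj, r₁]`
  -- the side conditions of the EulerPiece clause at this level
  have hT4θ₁ : ∀ m', E.θ (m' + 1) * ((E.N (m' + 1) : ℝ) / E.N m') ^ (1 / 16 : ℝ) ≤ θ₁ := fun m' =>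
    (hT4 m').trans ((min_le_right _ _).trans (by rw [hCα1, div_one]))
  have hNle : (E.N m : ℝ) ≤ ϱ₁ * E.N (m + 1) := by rw [hϱ1, one_mul] at hϱϱ₁; exact hϱϱ₁
  have hSw : ∃ lam ∈ Set.Icc (1:ℝ) Λ, Torus.NearIso S (lo / lam) (hi * lam) := ⟨1, ⟨le_rfl, hΛ.le⟩, by rw [div_one, mul_one]; exact hSn⟩
  have hΦSw : ∃ lam ∈ Set.Icc (1:ℝ) Λ, Torus.NearIso (Φ (E.cellVisc (m + 1)) S) (lo / lam) (hi * lam) :=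
    ⟨1, ⟨le_rfl, hΛ.le⟩, by rw [div_one, mul_one]; exact hΦSn⟩
  have hP1 : ∀ x y : V2, |⟪Um1 sj r₁ x - Um sj r₁ x, y⟫_ℝ|
      ≤ (Cm * (Cm * (ν ^ σ' + ((⌈K / ν⌉₊ : ℝ) / E.N (m + 1)) ^ σ' + (Cα * E.θ (m + 1)) ^ σ' + (ϱ * E.N m / E.N (m + 1)) ^ σ')
          + (min 1 ((M * W.period / ν) / (E.a (m + 1) * (r₁ - sj)))) ^ σ'))
        * Real.sqrt (lossFwd (Um sj r₁) x) * Real.sqrt (lossAdj (Um sj r₁) y) := by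
    intro x y
    have h := hMod E hdes hgain hLP hReg hN2 hT4θ₁ m hνν₀ hKn hNle S hSo hSw hΦSo hΦSw Um Um1 hUm hUm1 j sj r₁ hsj_def hsjr₁
      (le_of_eq hr₁) (hr₁s'.trans h3) x y
    rw [hCα1, hϱ1, one_mul, one_mul]
    exact h
  have hw1 : (M * W.period / ν) / (E.a (m + 1) * (r₁ - sj)) = E.physPeriod (m + 1) / R := by
    rw [hP1eq, hr₁]; ring_nf
  rw [hw1] at hP1
  have hT1le : (min 1 (E.physPeriod (m + 1) / R)) ^ σ' ≤ ρ ^ σz :=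
    transient_full_le hσ' hρ0 hρ1 (div_nonneg hP0.le hR.le) (by rw [div_le_iff₀ hR]; exact hPR)
  have hη₁le : Cm * (Cm * (ν ^ σ' + ((⌈K / ν⌉₊ : ℝ) / E.N (m + 1)) ^ σ' + (Cα * E.θ (m + 1)) ^ σ' + (ϱ * E.N m / E.N (m + 1)) ^ σ')
      + (min 1 (E.physPeriod (m + 1) / R)) ^ σ') ≤ Cη * ρ ^ σz := eta_full_le hCm hA hT1le
  have hη₁0 : 0 ≤ Cm * (Cm * (ν ^ σ' + ((⌈K / ν⌉₊ : ℝ) / E.N (m + 1)) ^ σ' + (Cα * E.θ (m + 1)) ^ σ' + (ϱ * E.N m / E.N (m + 1)) ^ σ')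
      + (min 1 (E.physPeriod (m + 1) / R)) ^ σ') := by
    have h1 : 0 ≤ ν ^ σ' := Real.rpow_nonneg hν.le σ'
    have h2 : 0 ≤ ((⌈K / ν⌉₊ : ℝ) / E.N (m + 1)) ^ σ' := Real.rpow_nonneg (by positivity) σ'
    have h3 : 0 ≤ (Cα * E.θ (m + 1)) ^ σ' := Real.rpow_nonneg (by have := E.θ_pos (m + 1); positivity) σ'
    have h4 : 0 ≤ (ϱ * E.N m / E.N (m + 1)) ^ σ' := Real.rpow_nonneg (by positivity) σ'
    have h5 : 0 ≤ (min 1 (E.physPeriod (m + 1) / R)) ^ σ' := Real.rpow_nonneg (le_min zero_le_one (div_nonneg hP0.le hR.le)) σ'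
    have : 0 ≤ Cm * (ν ^ σ' + ((⌈K / ν⌉₊ : ℝ) / E.N (m + 1)) ^ σ' + (Cα * E.θ (m + 1)) ^ σ' + (ϱ * E.N m / E.N (m + 1)) ^ σ') :=
      mul_nonneg hCm (by linarith only [h1, h2, h3, h4])
    exact mul_nonneg hCm (by linarith only [this, h5])
  -- the N-currency data
  set X2 : ℝ := ∑ k' ∈ Sf, min 1 ((E.a (m + 1) * (8 * Real.pi ^ 2 * ‖Torus.latticeVec k'‖ ^ 2 * lo * (E.cellVisc (m + 1) + c / E.cellVisc (m + 1)) / (E.N (m + 1) : ℝ) ^ 2)) * (s' - (j : ℝ) * E.refresh (m + 1))) * ‖UnitAddTorus.mFourierCoeff (EuclideanSpace.complexify ∘ ⇑(x)) k'‖ ^ 2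
      + (‖x‖ ^ 2 - ∑ k' ∈ Sf, ‖UnitAddTorus.mFourierCoeff (EuclideanSpace.complexify ∘ ⇑(x)) k'‖ ^ 2) with hX2
  set Y2 : ℝ := ∑ k' ∈ Sf, min 1 ((E.a (m + 1) * (8 * Real.pi ^ 2 * ‖Torus.latticeVec k'‖ ^ 2 * lo * (E.cellVisc (m + 1) + c / E.cellVisc (m + 1)) / (E.N (m + 1) : ℝ) ^ 2)) * (s' - (j : ℝ) * E.refresh (m + 1))) * ‖UnitAddTorus.mFourierCoeff (EuclideanSpace.complexify ∘ ⇑(y)) k'‖ ^ 2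
      + (‖y‖ ^ 2 - ∑ k' ∈ Sf, ‖UnitAddTorus.mFourierCoeff (EuclideanSpace.complexify ∘ ⇑(y)) k'‖ ^ 2) with hY2
  -- general data are read on their solenoidal parts (the αβ text is pre-projected, D27-4′)
  set Px : V2 := (Torus.divFreeL2 (Fin 3)).starProjection x with hPx
  set Py : V2 := (Torus.divFreeL2 (Fin 3)).starProjection y with hPy
  have hproj : ⟪Um1 sj s' x - Um sj s' x, y⟫_ℝ = ⟪Um1 sj s' Px - Um sj s' Px, Py⟫_ℝ :=
    pairing_eq_pairing_starProjection hUm hUm1 sj s' x y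
  have hCηCz : CN * Cη ≤ Cz := by
    have : 0 ≤ CN * Cη * (Real.sqrt (2 * Cmono) + Real.sqrt 2 * Cη) := by positivity
    have e : Cz = CN * Cη + (CN * Cη * (Real.sqrt (2 * Cmono) + Real.sqrt 2 * Cη) + 1) := by rw [hCz_def]; ring
    rw [e]; linarith only [this]
  -- case split on the post-refresh piece
  rcases hr₁s'.eq_or_lt with hEq | hLt
  · -- `s' = r₁`: one piece only
    have hb := hP1 Px Py
    rw [hEq] at hb
    have hs1 : Real.sqrt (lossFwd (Um sj s') Px) ≤ Real.sqrt CN * Real.sqrt X2 := by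
      rw [← Real.sqrt_mul hCN.le]; exact Real.sqrt_le_sqrt (hN1 x)
    have hs2 : Real.sqrt (lossAdj (Um sj s') Py) ≤ Real.sqrt CN * Real.sqrt Y2 := by
      rw [← Real.sqrt_mul hCN.le]; exact Real.sqrt_le_sqrt (hN1s y)
    have hCNsq : Real.sqrt CN * Real.sqrt CN = CN := Real.mul_self_sqrt hCN.le
    rw [hproj]
    calc |⟪Um1 sj s' Px - Um sj s' Px, Py⟫_ℝ|
        ≤ (Cη * ρ ^ σz) * (Real.sqrt CN * Real.sqrt X2) * (Real.sqrt CN * Real.sqrt Y2) :=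
          hb.trans (mul_le_mul (mul_le_mul hη₁le hs1 (Real.sqrt_nonneg _) (mul_nonneg hCη hρz0)) hs2 (Real.sqrt_nonneg _)
            (mul_nonneg (mul_nonneg hCη hρz0) (by positivity)))
      _ = (Cη * ρ ^ σz) * (Real.sqrt CN * Real.sqrt CN) * Real.sqrt X2 * Real.sqrt Y2 := by ring
      _ = (CN * Cη) * ρ ^ σz * Real.sqrt X2 * Real.sqrt Y2 := by rw [hCNsq]; ring
      _ ≤ Cz * ρ ^ σz * Real.sqrt X2 * Real.sqrt Y2 := by gcongr
      _ = ηz * Real.sqrt X2 * Real.sqrt Y2 := by rw [hηz]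
  · -- `r₁ < s'`: two pieces
    have hr₁cast : r₁ = ((j + 1 : ℕ) : ℝ) * E.refresh (m + 1) := by rw [hr₁_def]; push_cast; ring
    have hs'le : s' ≤ r₁ + E.refresh (m + 1) := by linarith only [hs'R]
    have hP2 : ∀ x y : V2, |⟪Um1 r₁ s' x - Um r₁ s' x, y⟫_ℝ|
        ≤ (Cm * (Cm * (ν ^ σ' + ((⌈K / ν⌉₊ : ℝ) / E.N (m + 1)) ^ σ' + (Cα * E.θ (m + 1)) ^ σ' + (ϱ * E.N m / E.N (m + 1)) ^ σ')
            + (min 1 ((M * W.period / ν) / (E.a (m + 1) * (s' - r₁)))) ^ σ'))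
          * Real.sqrt (lossFwd (Um r₁ s') x) * Real.sqrt (lossAdj (Um r₁ s') y) := by
      intro x y
      have h := hMod E hdes hgain hLP hReg hN2 hT4θ₁ m hνν₀ hKn hNle S hSo hSw hΦSo hΦSw Um Um1 hUm hUm1 (j + 1) r₁ s' hr₁cast hLt hs'le h3 x y
      rw [hCα1, hϱ1, one_mul, one_mul]
      exact h
    obtain ⟨hP2eq, -, -⟩ := period_facts E m hdes (hT5 m) (s' - r₁)
    rw [hP2eq] at hP2
    have hτ0 : 0 < s' - r₁ := by linarith only [hLt]
    have hv1 : (s' - r₁) / R ≤ 1 := (div_le_one hR).2 hs'R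
    have hT2le : (min 1 (E.physPeriod (m + 1) / (s' - r₁))) ^ σ' * Real.sqrt ((s' - r₁) / R) ≤ ρ ^ σz :=
      transient_short_mul_sqrt_le hσ' hρ0 hP0.le hR hτ0 hs'R hPR
    have hη₂le : Cm * (Cm * (ν ^ σ' + ((⌈K / ν⌉₊ : ℝ) / E.N (m + 1)) ^ σ' + (Cα * E.θ (m + 1)) ^ σ' + (ϱ * E.N m / E.N (m + 1)) ^ σ')
        + (min 1 (E.physPeriod (m + 1) / (s' - r₁))) ^ σ') ≤ Cη :=
      eta_short_le hCm hcA hσ' (div_nonneg hP0.le hτ0.le) hA hρz1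
    have hη₂sq : Cm * (Cm * (ν ^ σ' + ((⌈K / ν⌉₊ : ℝ) / E.N (m + 1)) ^ σ' + (Cα * E.θ (m + 1)) ^ σ' + (ϱ * E.N m / E.N (m + 1)) ^ σ')
        + (min 1 (E.physPeriod (m + 1) / (s' - r₁))) ^ σ') * Real.sqrt ((s' - r₁) / R) ≤ Cη * ρ ^ σz :=
      eta_short_mul_sqrt_le hCm hcA hρz0 hv1 hA hT2le
    have hη₂0 : 0 ≤ Cm * (Cm * (ν ^ σ' + ((⌈K / ν⌉₊ : ℝ) / E.N (m + 1)) ^ σ' + (Cα * E.θ (m + 1)) ^ σ' + (ϱ * E.N m / E.N (m + 1)) ^ σ')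
        + (min 1 (E.physPeriod (m + 1) / (s' - r₁))) ^ σ') := by
      have h1 : 0 ≤ ν ^ σ' := Real.rpow_nonneg hν.le σ'
      have h2 : 0 ≤ ((⌈K / ν⌉₊ : ℝ) / E.N (m + 1)) ^ σ' := Real.rpow_nonneg (by positivity) σ'
      have h3 : 0 ≤ (Cα * E.θ (m + 1)) ^ σ' := Real.rpow_nonneg (by have := E.θ_pos (m + 1); positivity) σ'
      have h4 : 0 ≤ (ϱ * E.N m / E.N (m + 1)) ^ σ' := Real.rpow_nonneg (by positivity) σ'
      have h5 : 0 ≤ (min 1 (E.physPeriod (m + 1) / (s' - r₁))) ^ σ' :=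
        Real.rpow_nonneg (le_min zero_le_one (div_nonneg hP0.le hτ0.le)) σ'
      have : 0 ≤ Cm * (ν ^ σ' + ((⌈K / ν⌉₊ : ℝ) / E.N (m + 1)) ^ σ' + (Cα * E.θ (m + 1)) ^ σ' + (ϱ * E.N m / E.N (m + 1)) ^ σ') :=
        mul_nonneg hCm (by linarith only [h1, h2, h3, h4])
      exact mul_nonneg hCm (by linarith only [this, h5])
    have hcomp := eulerian_compose hUm hUm1 hsj0 hsjr₁.le hLt.le h3 hη₁0 hη₂0 hCN.le hCmono.le (div_nonneg hτ0.le hR.le)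
      hP1 hP2 Px Py (hN1 x) (hN1s y) (hN2' Px)
    have hglue := glueConstant_le hη₁0 hCη hCN.le hCmono.le hη₁le hη₂le hη₂sq
    have hXY : 0 ≤ Real.sqrt X2 * Real.sqrt Y2 := by positivity
    have hDle : CN * Cη * (Real.sqrt (2 * Cmono) + Real.sqrt 2 * Cη + 1) * ρ ^ σz ≤ Cz * ρ ^ σz := by
      have hle : CN * Cη * (Real.sqrt (2 * Cmono) + Real.sqrt 2 * Cη + 1) ≤ Cz := by rw [hCz_def]; linarith only []
      exact mul_le_mul_of_nonneg_right hle hρz0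
    have key : ∀ G : ℝ, G * CN ≤ CN * Cη * (Real.sqrt (2 * Cmono) + Real.sqrt 2 * Cη + 1) * ρ ^ σz →
        G * CN * Real.sqrt X2 * Real.sqrt Y2 ≤ ηz * Real.sqrt X2 * Real.sqrt Y2 := by
      intro G hG
      rw [hηz]
      calc G * CN * Real.sqrt X2 * Real.sqrt Y2 = (G * CN) * (Real.sqrt X2 * Real.sqrt Y2) := by ring
        _ ≤ (CN * Cη * (Real.sqrt (2 * Cmono) + Real.sqrt 2 * Cη + 1) * ρ ^ σz) * (Real.sqrt X2 * Real.sqrt Y2) :=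
            mul_le_mul_of_nonneg_right hG hXY
        _ ≤ (Cz * ρ ^ σz) * (Real.sqrt X2 * Real.sqrt Y2) := mul_le_mul_of_nonneg_right hDle hXY
        _ = Cz * ρ ^ σz * Real.sqrt X2 * Real.sqrt Y2 := by ring
    rw [hproj]
    exact hcomp.trans (key _ hglue)



/-! (The `X := Xθ` instances — `cellInputs_BIL_ofEulerθ`, `vmod_E_textHTθ_of_textHT` — are PARKED by RULING D28-2 (v28 HOLD, certifier F-p5g15-1 on the
(V_θ) text); they return once the repaired (V_θ) line is ruled (D28-3).) -/

end Summit.AnomalousDissipation.AnomalousDissipation.Theorems.SolenoidalFractalHomogenisation.LagrangianStep.Z7Glue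

end
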